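import Mathlib
import HarnessLib

/-!
# The third-order chain rule along a real curve as a `HasDerivAt` chain, with the Faà di Bruno bound and the bound of an INCREMENT of curves

Topic `Literature/Analysis/Calculus`; companion of `IteratedDifferenceBound` (`norm_fwdDiff_iter_le_of_hasDerivAt`: `N` forward differences of
`g 0` are bounded by `δᴺ·sup ‖g N‖` along a `HasDerivAt` chain `g 0, …, g N`).  For a complex function `g` of one real variable with derivatives
`g₁, g₂, g₃` everywhere and a real curve `u` with derivatives `u₁, u₂, u₃`, the composite `t ↦ g(u t)` heads the explicit chain
`G₁ = g₁(u)·u₁`, `G₂ = g₂(u)·u₁² + g₁(u)·u₂`, `G₃ = g₃(u)·u₁³ + 3g₂(u)·u₁u₂ + g₁(u)·u₃` (Faà di Bruno to order three), so that third DIFFERENCES of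
`g ∘ u` along the line are controlled by `sup ‖G₃‖ ≤ C₃D³ + 3C₂D·D₂ + C₁D₃`.  For the telescoping of a single-scale symbol over the pieces of a framed
band (Benfatto–Giuliani–Mastropietro 2006, §3 (3.2)–(3.8)) one also needs the INCREMENT between the chains of two curves `u` and `u + w`: every term
of `G₃[u+w] − G₃[u]` carries either an increment `g_k(u + w) − g_k(u)` (`≤ C_{k+1}·|w|` by the mean value inequality) or a derivative of `w`.

* `hasDerivAt_chain3_comp` — the chain `G 0 … G 3` of `g ∘ u` and its `HasDerivAt` links;
* `norm_chain3_three_le` — `‖G₃ t‖ ≤ C₃|u₁|³ + 3C₂|u₁||u₂| + C₁|u₃|`;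
* `norm_chain3_three_sub_le` — the increment bound for two curves `u`, `u + w` (with `‖g_k(x + y) − g_k(x)‖ ≤ C_{k+1}|y|`, `k = 1,2,3`).

Everything is proved; no definitions; no named facts. [folklore]

## Sources

G. Benfatto, A. Giuliani, V. Mastropietro, Ann. Henri Poincaré 7 (2006) 809–898, (2.36aa), §3 (3.2)–(3.8) (`BenfattoGiulianiMastropietro2006`).
Routine calculus ("folklore").
-/

noncomputable section

namespace Literature.Analysis.Calculus

open Complex

/-- **The third-order chain of a composite `g ∘ u`** (`g : ℝ → ℂ` with derivatives `g₁, g₂, g₃` everywhere; `u : ℝ → ℝ` with derivatives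
`u₁, u₂, u₃` everywhere): with `G 0 = g ∘ u`, `G 1 = g₁(u)·u₁`, `G 2 = g₂(u)·u₁² + g₁(u)·u₂`, `G 3 = g₃(u)·u₁³ + 3·g₂(u)·u₁·u₂ + g₁(u)·u₃`
(and `G k = 0` for `k ≥ 4`), `HasDerivAt (G k) (G (k+1) t) t` for `k < 3`. [cite: BenfattoGiulianiMastropietro2006, (2.36aa)] -/
theorem hasDerivAt_chain3_comp {g g₁ g₂ g₃ : ℝ → ℂ} {u u₁ u₂ u₃ : ℝ → ℝ}
    (hg : ∀ x, HasDerivAt g (g₁ x) x) (hg₁ : ∀ x, HasDerivAt g₁ (g₂ x) x) (hg₂ : ∀ x, HasDerivAt g₂ (g₃ x) x)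
    (hu : ∀ t, HasDerivAt u (u₁ t) t) (hu₁ : ∀ t, HasDerivAt u₁ (u₂ t) t) (hu₂ : ∀ t, HasDerivAt u₂ (u₃ t) t) :
    let G : ℕ → ℝ → ℂ := fun k t =>
      if k = 0 then g (u t)
      else if k = 1 then g₁ (u t) * (u₁ t : ℂ)
      else if k = 2 then g₂ (u t) * (u₁ t : ℂ) ^ 2 + g₁ (u t) * (u₂ t : ℂ)
      else if k = 3 then g₃ (u t) * (u₁ t : ℂ) ^ 3 + 3 * (g₂ (u t) * (u₁ t : ℂ) * (u₂ t : ℂ)) + g₁ (u t) * (u₃ t : ℂ)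
      else 0
    ∀ k < 3, ∀ t, HasDerivAt (G k) (G (k + 1) t) t := by
  intro G k hk t
  -- real derivatives lifted to `ℂ`
  have hc : ∀ {v v' : ℝ → ℝ}, (∀ s, HasDerivAt v (v' s) s) → ∀ s, HasDerivAt (fun s => (v s : ℂ)) ((v' s : ℂ)) s :=
    fun h s => HasDerivAt.ofReal_comp (h s)
  -- the composites `g_k ∘ u`
  have hcomp : ∀ {f f' : ℝ → ℂ}, (∀ x, HasDerivAt f (f' x) x) → ∀ s, HasDerivAt (fun s => f (u s)) (f' (u s) * (u₁ s : ℂ)) s := by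
    intro f f' hf s
    have h := (hf (u s)).scomp s (hu s)
    have e : (u₁ s) • f' (u s) = f' (u s) * (u₁ s : ℂ) := by rw [Complex.real_smul, mul_comm]
    rw [e] at h
    exact h
  interval_cases k
  · -- k = 0
    show HasDerivAt (fun t => g (u t)) (g₁ (u t) * (u₁ t : ℂ)) t
    exact hcomp hg t
  · -- k = 1
    show HasDerivAt (fun t => g₁ (u t) * (u₁ t : ℂ)) (g₂ (u t) * (u₁ t : ℂ) ^ 2 + g₁ (u t) * (u₂ t : ℂ)) t
    have h := (hcomp hg₁ t).mul (hc hu₁ t)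
    refine h.congr_deriv ?_
    ring
  · -- k = 2
    show HasDerivAt (fun t => g₂ (u t) * (u₁ t : ℂ) ^ 2 + g₁ (u t) * (u₂ t : ℂ))
      (g₃ (u t) * (u₁ t : ℂ) ^ 3 + 3 * (g₂ (u t) * (u₁ t : ℂ) * (u₂ t : ℂ)) + g₁ (u t) * (u₃ t : ℂ)) t
    have h1 := (hcomp hg₂ t).mul ((hc hu₁ t).pow 2)
    have h2 := (hcomp hg₁ t).mul (hc hu₂ t)
    refine (h1.add h2).congr_deriv ?_
    simp only [Nat.cast_ofNat, Pi.pow_apply]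
    ring

/-- **The Faà di Bruno bound at order three**: `‖g₃(u)·u₁³ + 3g₂(u)·u₁u₂ + g₁(u)·u₃‖ ≤ C₃|u₁|³ + 3C₂|u₁||u₂| + C₁|u₃|`
(`‖g_k‖ ≤ C_k`). [cite: BenfattoGiulianiMastropietro2006, (2.36aa)] -/
theorem norm_chain3_three_le {g₁ g₂ g₃ : ℝ → ℂ} {C₁ C₂ C₃ : ℝ} (h₁ : ∀ x, ‖g₁ x‖ ≤ C₁) (h₂ : ∀ x, ‖g₂ x‖ ≤ C₂) (h₃ : ∀ x, ‖g₃ x‖ ≤ C₃)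
    (x a b c : ℝ) :
    ‖g₃ x * (a : ℂ) ^ 3 + 3 * (g₂ x * (a : ℂ) * (b : ℂ)) + g₁ x * (c : ℂ)‖ ≤ C₃ * |a| ^ 3 + 3 * (C₂ * |a| * |b|) + C₁ * |c| := by
  have hC₂ : 0 ≤ C₂ := (norm_nonneg _).trans (h₂ 0)
  have e1 : ‖g₃ x * (a : ℂ) ^ 3‖ ≤ C₃ * |a| ^ 3 := by
    rw [norm_mul, norm_pow, Complex.norm_real, Real.norm_eq_abs]
    exact mul_le_mul_of_nonneg_right (h₃ x) (by positivity)
  have e2 : ‖3 * (g₂ x * (a : ℂ) * (b : ℂ))‖ ≤ 3 * (C₂ * |a| * |b|) := by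
    rw [norm_mul, Complex.norm_ofNat, norm_mul, norm_mul, Complex.norm_real, Complex.norm_real, Real.norm_eq_abs, Real.norm_eq_abs]
    refine mul_le_mul_of_nonneg_left ?_ (by norm_num)
    exact mul_le_mul_of_nonneg_right (mul_le_mul_of_nonneg_right (h₂ x) (abs_nonneg a)) (abs_nonneg b)
  have e3 : ‖g₁ x * (c : ℂ)‖ ≤ C₁ * |c| := by
    rw [norm_mul, Complex.norm_real, Real.norm_eq_abs]
    exact mul_le_mul_of_nonneg_right (h₁ x) (abs_nonneg c)
  exact ((norm_add_le _ _).trans (add_le_add ((norm_add_le _ _).trans (add_le_add e1 e2)) e3))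

/-- **The increment of the order-three chain between two curves** `u` and `u + w`:
`‖G₃[u+w] − G₃[u]‖ ≤ C₄|w|(|a|+|a′|)³ + C₃·|(a+a′)³ − a³| + 3·(C₃|w|(|a|+|a′|)(|b|+|b′|) + C₂|(a+a′)(b+b′) − ab|) + C₂|w|(|c|+|c′|) + C₁|c′|`
where `(a, b, c) = (u₁, u₂, u₃)`, `(a′, b′, c′) = (w₁, w₂, w₃)` at the point and `‖g_k(x + y) − g_k(x)‖ ≤ C_{k+1}|y|` (`k = 1, 2, 3`),
`‖g_k‖ ≤ C_k`.  Every term carries an increment of `g_k` (a factor `|w|`) or a derivative of `w`. [cite: BenfattoGiulianiMastropietro2006, §3 (3.2)] -/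
theorem norm_chain3_three_sub_le {g₁ g₂ g₃ : ℝ → ℂ} {C₁ C₂ C₃ C₄ : ℝ} (h₁ : ∀ x, ‖g₁ x‖ ≤ C₁) (h₂ : ∀ x, ‖g₂ x‖ ≤ C₂) (h₃ : ∀ x, ‖g₃ x‖ ≤ C₃)
    (i₁ : ∀ x y, ‖g₁ (x + y) - g₁ x‖ ≤ C₂ * |y|) (i₂ : ∀ x y, ‖g₂ (x + y) - g₂ x‖ ≤ C₃ * |y|)
    (i₃ : ∀ x y, ‖g₃ (x + y) - g₃ x‖ ≤ C₄ * |y|) (x y a b c a' b' c' : ℝ) :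
    ‖(g₃ (x + y) * ((a + a' : ℝ) : ℂ) ^ 3 + 3 * (g₂ (x + y) * ((a + a' : ℝ) : ℂ) * ((b + b' : ℝ) : ℂ)) + g₁ (x + y) * ((c + c' : ℝ) : ℂ)) -
        (g₃ x * (a : ℂ) ^ 3 + 3 * (g₂ x * (a : ℂ) * (b : ℂ)) + g₁ x * (c : ℂ))‖ ≤
      C₄ * |y| * (|a| + |a'|) ^ 3 + C₃ * |(a + a') ^ 3 - a ^ 3| +
        3 * (C₃ * |y| * ((|a| + |a'|) * (|b| + |b'|)) + C₂ * |(a + a') * (b + b') - a * b|) +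
        (C₂ * |y| * (|c| + |c'|) + C₁ * |c'|) := by
  have hC₁ : 0 ≤ C₁ := (norm_nonneg _).trans (h₁ 0)
  have hC₂ : 0 ≤ C₂ := (norm_nonneg _).trans (h₂ 0)
  have hC₃ : 0 ≤ C₃ := (norm_nonneg _).trans (h₃ 0)
  -- regroup: Σ [Δg·new + g·Δ(poly)]
  have key : (g₃ (x + y) * ((a + a' : ℝ) : ℂ) ^ 3 + 3 * (g₂ (x + y) * ((a + a' : ℝ) : ℂ) * ((b + b' : ℝ) : ℂ)) +
        g₁ (x + y) * ((c + c' : ℝ) : ℂ)) - (g₃ x * (a : ℂ) ^ 3 + 3 * (g₂ x * (a : ℂ) * (b : ℂ)) + g₁ x * (c : ℂ)) =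
      ((g₃ (x + y) - g₃ x) * ((a + a' : ℝ) : ℂ) ^ 3 + g₃ x * (((a + a' : ℝ) : ℂ) ^ 3 - (a : ℂ) ^ 3)) +
      3 * ((g₂ (x + y) - g₂ x) * (((a + a' : ℝ) : ℂ) * ((b + b' : ℝ) : ℂ)) +
        g₂ x * (((a + a' : ℝ) : ℂ) * ((b + b' : ℝ) : ℂ) - (a : ℂ) * (b : ℂ))) +
      ((g₁ (x + y) - g₁ x) * ((c + c' : ℝ) : ℂ) + g₁ x * ((c' : ℝ) : ℂ)) := by
    push_cast; ring
  rw [key]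
  have nA : ‖((a + a' : ℝ) : ℂ)‖ ≤ |a| + |a'| := by rw [Complex.norm_real, Real.norm_eq_abs]; exact abs_add_le _ _
  have nB : ‖((b + b' : ℝ) : ℂ)‖ ≤ |b| + |b'| := by rw [Complex.norm_real, Real.norm_eq_abs]; exact abs_add_le _ _
  have nC : ‖((c + c' : ℝ) : ℂ)‖ ≤ |c| + |c'| := by rw [Complex.norm_real, Real.norm_eq_abs]; exact abs_add_le _ _
  have t1 : ‖(g₃ (x + y) - g₃ x) * ((a + a' : ℝ) : ℂ) ^ 3‖ ≤ C₄ * |y| * (|a| + |a'|) ^ 3 := by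
    rw [norm_mul, norm_pow]
    exact mul_le_mul (i₃ x y) (pow_le_pow_left₀ (norm_nonneg _) nA 3) (by positivity) ((norm_nonneg _).trans (i₃ x y))
  have t2 : ‖g₃ x * (((a + a' : ℝ) : ℂ) ^ 3 - (a : ℂ) ^ 3)‖ ≤ C₃ * |(a + a') ^ 3 - a ^ 3| := by
    rw [norm_mul, show (((a + a' : ℝ) : ℂ) ^ 3 - (a : ℂ) ^ 3) = (((a + a') ^ 3 - a ^ 3 : ℝ) : ℂ) by push_cast; ring,
      Complex.norm_real, Real.norm_eq_abs]
    exact mul_le_mul_of_nonneg_right (h₃ x) (abs_nonneg _)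
  have t3 : ‖(g₂ (x + y) - g₂ x) * (((a + a' : ℝ) : ℂ) * ((b + b' : ℝ) : ℂ))‖ ≤ C₃ * |y| * ((|a| + |a'|) * (|b| + |b'|)) := by
    rw [norm_mul, norm_mul]
    exact mul_le_mul (i₂ x y) (mul_le_mul nA nB (norm_nonneg _) (by positivity)) (by positivity) ((norm_nonneg _).trans (i₂ x y))
  have t4 : ‖g₂ x * (((a + a' : ℝ) : ℂ) * ((b + b' : ℝ) : ℂ) - (a : ℂ) * (b : ℂ))‖ ≤ C₂ * |(a + a') * (b + b') - a * b| := by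
    rw [norm_mul, show (((a + a' : ℝ) : ℂ) * ((b + b' : ℝ) : ℂ) - (a : ℂ) * (b : ℂ)) = (((a + a') * (b + b') - a * b : ℝ) : ℂ) by
      push_cast; ring, Complex.norm_real, Real.norm_eq_abs]
    exact mul_le_mul_of_nonneg_right (h₂ x) (abs_nonneg _)
  have t5 : ‖(g₁ (x + y) - g₁ x) * ((c + c' : ℝ) : ℂ)‖ ≤ C₂ * |y| * (|c| + |c'|) := by
    rw [norm_mul]
    exact mul_le_mul (i₁ x y) nC (norm_nonneg _) ((norm_nonneg _).trans (i₁ x y))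
  have t6 : ‖g₁ x * ((c' : ℝ) : ℂ)‖ ≤ C₁ * |c'| := by
    rw [norm_mul, Complex.norm_real, Real.norm_eq_abs]
    exact mul_le_mul_of_nonneg_right (h₁ x) (abs_nonneg _)
  calc _ ≤ ‖(g₃ (x + y) - g₃ x) * ((a + a' : ℝ) : ℂ) ^ 3 + g₃ x * (((a + a' : ℝ) : ℂ) ^ 3 - (a : ℂ) ^ 3)‖ +
        ‖3 * ((g₂ (x + y) - g₂ x) * (((a + a' : ℝ) : ℂ) * ((b + b' : ℝ) : ℂ)) +
          g₂ x * (((a + a' : ℝ) : ℂ) * ((b + b' : ℝ) : ℂ) - (a : ℂ) * (b : ℂ)))‖ +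
        ‖(g₁ (x + y) - g₁ x) * ((c + c' : ℝ) : ℂ) + g₁ x * ((c' : ℝ) : ℂ)‖ :=
        (norm_add_le _ _).trans (add_le_add (norm_add_le _ _) le_rfl)
    _ ≤ (C₄ * |y| * (|a| + |a'|) ^ 3 + C₃ * |(a + a') ^ 3 - a ^ 3|) +
        3 * (C₃ * |y| * ((|a| + |a'|) * (|b| + |b'|)) + C₂ * |(a + a') * (b + b') - a * b|) +
        (C₂ * |y| * (|c| + |c'|) + C₁ * |c'|) := by
        refine add_le_add (add_le_add ((norm_add_le _ _).trans (add_le_add t1 t2)) ?_) ((norm_add_le _ _).trans (add_le_add t5 t6))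
        rw [norm_mul, Complex.norm_ofNat]
        exact mul_le_mul_of_nonneg_left ((norm_add_le _ _).trans (add_le_add t3 t4)) (by norm_num)
    _ = _ := by ring

end Literature.Analysis.Calculus

end
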